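import Summits.BirchSwinnertonDyer.BirchSwinnertonDyer.Theorems.KatoDescentPotSupersingularFineSelmerDescentOfDivisibility
import Summits.BirchSwinnertonDyer.BirchSwinnertonDyer.Theorems.KatoDescentPotSupersingularMuCoreIrrCore
import HarnessLib

/-!
# Kato's Λ-adic divisibility `char X₀(W/ℚ_∞) ∣ char(𝐇¹_Γ/Λs)` and its descent to level 0 on EVERY irreducible
# non-CM row at `p = 3` — `ρ̄_{E,3}` onto or not — from a `3`-indivisible genuine Euler-system class, modulo
# {Kato 13.4 fact, Serre III.7.9 (a)} only (route `KatoDescentPotSupersingular`, U₀ parent item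
# stmt-BirchSwinnertonDyer-19197 / U₀-ns node 19189; route-free helper)

Seat `bsd-potss-k9-c4` g14 (prover; cell `bsd-potss`); `--supports stmt-BirchSwinnertonDyer-19197 --as helper`;
closes nothing.  HONEST FRAMING: BSD is not proved by any of this; nothing is booked; THEOREMS ONLY; the divisibility
and descent are rkm g15/g16's (`…SmallImageEulerSystemDivisibilityIrreducible`, `…FineSelmerDescentOfDivisibility` §2,
item 19196), re-keyed here from `ρ̄_{E,p}` not onto to the image facts (SC)/(IF) of the K6 `μ`-core (parts A–G,
`…MuCoreIrr*`), which hold at `p = 3` for EVERY `E/ℚ` with `E[3]` irreducible.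

WHY (item 19197 / node 19189 `WildUpperNonsurjTower`).  rkm g15's fine road served the U₀-ns rows with `ρ̄₃` NOT onto
(Cartan images).  The remaining U₀-ns rows — Elkies' 9-deficient rows, `ρ̄₃` onto `GL₂(𝔽₃)`, `ρ̄₉` not — were outside
its binder.  With `CoreAssembly.coreThree_anyReduction_of_irr` (part G) the same road now covers them:

* `charIdeal_le_charIdeal_fineSelmerDual_of_irreducible_of_imageFacts` — every odd `p`, (SC)+(IF) in place of
  `¬Surj` (rkm g15's proof verbatim, the `(p)`-part from `coreIrr_anyReduction_holds`);
* **`charIdeal_le_charIdeal_fineSelmerDual_three_of_irreducible`** — `p = 3`, `E[3]` irreducible, non-CM, NO image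
  binder: `char_Λ(𝐇¹_Γ/Λs) ⊆ char_Λ X₀(W/ℚ_∞)` for every genuine Euler-system class `s ∉ 3𝐇¹_Γ` with `𝐇¹_Γ/Λs` torsion;
* **`natCard_fineSelmer_mul_descentCokernel_dvd_three_of_irreducible`** — the descent to the `Γ`-(co)invariants and
  to level 0 (rkm g16 §1 row-free descent fed with the above): on a rank-0 row,
  `#Sel₀(W/ℚ_∞)^Γ · #desc ∣ #Sel₀(W/ℚ_∞)_Γ · [H¹(ℤ[1/3],T_3W) : ℤ₃ s₀]` and
  `#Sel₀(ℚ, W[3^∞]) · #desc ∣ #W[3^∞]^{Γ_ℚ} · #Sel₀(W/ℚ_∞)_Γ · [H¹(ℤ[1/3],T_3W) : ℤ₃ s₀]`.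

Open input on these rows (unchanged from the Cartan rows): the `3`-indivisibility `s ∉ 3·𝐇¹_Γ` of Kato's zeta class
(«`μ` of the zeta ideal `= 0`»), displayed, not supplied.  References: [Kato2004Asterisque] Thm. 12.5 (4), Thm. 13.4,
§13.8, Thm. 14.5 (3), §14.14; [SilvermanAEC2009] III.7.9 (a); [GreenbergLNM1716] §4 Lemmas 4.2–4.3; [Serre1972]
§2.4–2.6.
-/

-- the summit and its single problem are both named `BirchSwinnertonDyer` (registry layout D-0017)
set_option linter.dupNamespace false
set_option autoImplicit false

noncomputable section

open scoped NumberField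
open Field IsDedekindDomain WeierstrassCurve
open Literature.NumberTheory.GaloisRepresentations Literature.NumberTheory.EllipticCurves
open Literature.NumberTheory.EllipticCurves.GreenbergSelmer
open Literature.NumberTheory.EllipticCurves.Kato2004 Literature.NumberTheory.EllipticCurves.Kato2004.EulerSystemValues
open Literature.NumberTheory.EllipticCurves.IwasawaAlgebra Literature.NumberTheory.EllipticCurves.IwasawaDual

namespace Summit.BirchSwinnertonDyer.BirchSwinnertonDyer.Theorems.MuCoreIrr

/-! ## §1 The Λ-adic divisibility under image facts, and at `p = 3` under `Irr` alone -/

section Divisibility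

variable (W : WeierstrassCurve ℚ) [W.IsElliptic] [W.IsGloballyMinimal] (p : ℕ) [Fact p.Prime]
  [ContinuousSMul ℤ_[p] (W.tateModule p)] [Module.Free ℤ_[p] (W.tateModule p)]
  [Module.Finite ℤ_[p] (W.tateModule p)]

/-- **Kato's divisibility from a `p`-indivisible Euler-system class under the IMAGE FACTS (SC)+(IF)** (twin of rkm
g15's `charIdeal_le_charIdeal_fineSelmerDual_of_irreducible_of_not_surjective`; proof verbatim with the `(p)`-part
from `CoreAssembly.coreIrr_anyReduction_holds`): `char_Λ(𝐇¹_Γ/Λs) ⊆ char_Λ X₀(W/ℚ_∞)`, modulo {Kato Thm. 13.4 fact,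
Serre's open image}. [cite: Kato2004Asterisque, Thm. 13.4 (2) (p. 226) and Thm. 12.5 (4) (p. 222)]
[cite: SilvermanAEC2009, Thm. III.7.9 (a)] -/
theorem charIdeal_le_charIdeal_fineSelmerDual_of_irreducible_of_imageFacts
    (h134 : thm13_4_lengthAt_fineSelmerDual_le_of_isEulerSystemClass)
    (hSerre : serre_adicImage_contains_congruenceSubgroup)
    (κ : ZpExtension ℚ p) (γ : absoluteGaloisGroup ℚ) (hp : p ≠ 2) (hκ : κ.IsCyclotomic)
    (hγ : κ.IsTopGenerator γ) (hCM : ¬ W.HasCM) (hirr : W.HasIrreducibleModPGaloisRep p)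
    (hSC : ∃ (z : absoluteGaloisGroup ℚ) (a : ZMod p), a ≠ 1 ∧
      ∀ P : WeierstrassCurve.geomTorsion W (p : ℤ), z • P = a.val • P)
    (hIF : ∀ N : Subgroup (absoluteGaloisGroup ℚ), N.Normal →
      (WeierstrassCurve.galoisRepTorsion W (p : ℕ)).ker ≤ N → N.index ≠ p)
    (I : IwasawaH1Data W p κ γ) (Y : W.FineSelmerDualData κ γ) (s : I.H)
    (hs : IsEulerSystemClass W p κ γ I s)
    (hsp : s ∉ IwasawaAlgebra.augIdealP p • (⊤ : Submodule (IwasawaAlgebra p) I.H))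
    (htors : Module.IsTorsion (IwasawaAlgebra p) (I.H ⧸ Submodule.span (IwasawaAlgebra p) {s})) :
    Module.charIdeal (IwasawaAlgebra p) (I.H ⧸ Submodule.span (IwasawaAlgebra p) {s}) ≤
      Module.charIdeal (IwasawaAlgebra p) Y.X := by
  have hs0 : s ≠ 0 := by
    rintro rfl
    exact hsp (Submodule.zero_mem _)
  -- `(p)`-part: the kernel μ-transfer under image facts
  obtain ⟨J, hJ⟩ :=
    Rank1Residual.CoreAssembly.coreIrr_anyReduction_holds W p κ γ I hp hirr hSC hIF hκ hγ ⟨s, hs, hsp⟩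
  have hfin := W.finite_fineSelmerInfty_pTorsion_of_forall_iterate_eq_zero κ hγ hJ
  haveI : Module.Finite (IwasawaAlgebra p) Y.X := Y.module_finite_of_finite_pTorsion hγ hfin
  haveI : Finite (Y.X ⧸ (IwasawaAlgebra.augIdealP p • (⊤ : Submodule (IwasawaAlgebra p) Y.X))) :=
    Y.finite_quotient_augIdealP_of_finite_pTorsion hfin
  have hYtors : Module.IsTorsion (IwasawaAlgebra p) Y.X :=
    IwasawaModuleFinitePadicInt.isTorsion_of_finite_quotient_augIdealP p Y.X inferInstance
  haveI : Module.Finite (IwasawaAlgebra p) I.H := IwasawaH1Data.module_finite_of_isCyclotomic hκ hγ I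
  refine Kim2025.charIdeal_le_charIdeal_of_lengthAt_le htors hYtors fun 𝔭 h𝔭 ↦ ?_
  by_cases hp𝔭 : PowerSeries.C (p : ℤ_[p]) ∈ 𝔭.asIdeal
  · have h0 := Rank1Residual.KatoMuSkeleton.lengthAt_eq_zero_of_finite_quotient_p (M := Y.X) 𝔭
      (eq_augIdealP_of_height_eq_one_of_C_mem 𝔭 h𝔭 hp𝔭)
    simp [h0]
  · exact SmallImageEulerSystemBoundOffP.lengthAt_fineSelmerDual_le_of_isEulerSystemClass_of_not_hasCM h134
      hSerre W p κ γ hp hκ hγ hCM I Y s hs hs0 𝔭 h𝔭 hp𝔭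

end Divisibility

section Three

variable (W : WeierstrassCurve ℚ) [W.IsElliptic] [W.IsGloballyMinimal] [Fact (Nat.Prime 3)]
  [ContinuousSMul ℤ_[3] (W.tateModule 3)] [Module.Free ℤ_[3] (W.tateModule 3)]
  [Module.Finite ℤ_[3] (W.tateModule 3)]

/-- **Kato's divisibility at `p = 3` on EVERY irreducible non-CM row, `ρ̄_{E,3}` onto or not** (9-deficient rows
included): for the cyclotomic `(κ, γ)`, pinned `I`, any `Y`, and a genuine Λ-adic Euler-system class `s ∉ 3𝐇¹_Γ` with
`𝐇¹_Γ/Λs` torsion, `char_Λ(𝐇¹_Γ/Λs) ⊆ char_Λ X₀(W/ℚ_∞)` — modulo {Kato Thm. 13.4 fact, Serre's open image} only;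
(SC) from `imageFactSC_three_of_irr`, (IF) from `IrrThreeDisjoint.forall_normal_index_ne_three_of_irr`.
[cite: Kato2004Asterisque, Thm. 13.4 (2) (p. 226) and Thm. 12.5 (4) (p. 222)] [cite: SilvermanAEC2009, Thm. III.7.9 (a)]
[cite: Serre1972, §2.4 Prop. 15, §2.5–2.6] -/
theorem charIdeal_le_charIdeal_fineSelmerDual_three_of_irreducible
    (h134 : thm13_4_lengthAt_fineSelmerDual_le_of_isEulerSystemClass)
    (hSerre : serre_adicImage_contains_congruenceSubgroup)
    (κ : ZpExtension ℚ 3) (γ : absoluteGaloisGroup ℚ) (hκ : κ.IsCyclotomic) (hγ : κ.IsTopGenerator γ)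
    (hCM : ¬ W.HasCM) (hirr : W.HasIrreducibleModPGaloisRep 3)
    (I : IwasawaH1Data W 3 κ γ) (Y : W.FineSelmerDualData κ γ) (s : I.H)
    (hs : IsEulerSystemClass W 3 κ γ I s)
    (hsp : s ∉ IwasawaAlgebra.augIdealP 3 • (⊤ : Submodule (IwasawaAlgebra 3) I.H))
    (htors : Module.IsTorsion (IwasawaAlgebra 3) (I.H ⧸ Submodule.span (IwasawaAlgebra 3) {s})) :
    Module.charIdeal (IwasawaAlgebra 3) (I.H ⧸ Submodule.span (IwasawaAlgebra 3) {s}) ≤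
      Module.charIdeal (IwasawaAlgebra 3) Y.X :=
  charIdeal_le_charIdeal_fineSelmerDual_of_irreducible_of_imageFacts W 3 h134 hSerre κ γ (by decide) hκ hγ hCM
    hirr (Rank1Residual.imageFactSC_three_of_irr W hirr)
    (IrrThreeDisjoint.forall_normal_index_ne_three_of_irr W hirr) I Y s hs hsp htors

variable [Finite W.toAffine.Point] [Finite (AddCommGroup.primaryComponent W.sha 3)]

/-- **Kato Thm. 14.5 (3) on the fine road, `Γ`-level and level 0, at `p = 3` on EVERY irreducible non-CM rank-0 row**
(`ρ̄_{E,3}` onto or not; twin of rkm g16's `natCard_fineSelmer_mul_descentCokernel_dvd_of_irreducible_of_not_surjective`):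
for `W(ℚ)`, `Ш(W)[3^∞]` finite, a genuine Λ-adic Euler-system class `s ∉ 3·𝐇¹_Γ` with `proj₀ s` of infinite order,
`#Sel₀(W/ℚ_∞)^Γ · #desc ∣ #Sel₀(W/ℚ_∞)_Γ · [H¹(ℤ[1/3],T_3W) : ℤ₃ s₀]` and
`#Sel₀(ℚ, W[3^∞]) · #desc ∣ #W[3^∞]^{Γ_ℚ} · #Sel₀(W/ℚ_∞)_Γ · [H¹(ℤ[1/3],T_3W) : ℤ₃ s₀]` — modulo
{`thm13_4_…`, `serre_adicImage_…`} only. [cite: Kato2004Asterisque, Thm. 13.4 (2) (p. 226), Thm. 14.5 (3) (p. 236), §14.14 (pp. 243–244)]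
[cite: GreenbergLNM1716, §4 Lemmas 4.2–4.3 (pp. 102–103)] [cite: SilvermanAEC2009, Thm. III.7.9 (a)] -/
theorem natCard_fineSelmer_mul_descentCokernel_dvd_three_of_irreducible
    (h134 : thm13_4_lengthAt_fineSelmerDual_le_of_isEulerSystemClass)
    (hSerre : serre_adicImage_contains_congruenceSubgroup)
    {κ : ZpExtension ℚ 3} {γ : absoluteGaloisGroup ℚ} (hκ : κ.IsCyclotomic) (hγ : κ.IsTopGenerator γ)
    (hCM : ¬ W.HasCM) (hirr : W.HasIrreducibleModPGaloisRep 3)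
    (I : IwasawaH1Data W 3 κ γ) (Y : W.FineSelmerDualData κ γ) (s : I.H) (hs : IsEulerSystemClass W 3 κ γ I s)
    (hsp : s ∉ IwasawaAlgebra.augIdealP 3 • (⊤ : Submodule (IwasawaAlgebra 3) I.H))
    (hnt : ¬ IsOfFinAddOrder (I.proj 0 s)) :
    (Nat.card (endInvariants (W.conjFineSelmerInfty κ γ - 1)) * Nat.card I.descentCokernel ∣
        Nat.card (EndCoinvariants (W.conjFineSelmerInfty κ γ - 1)) *
          Nat.card (integralH1 (tateRep W 3) 3 (κ.layerSubgroup 0) ⧸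
            Submodule.span ℤ_[3] {(⟨I.proj 0 s, I.proj_mem 0 s⟩ :
              integralH1 (tateRep W 3) 3 (κ.layerSubgroup 0))})) ∧
      Nat.card (strictSelmerGroupOver (κ.layerSubgroup 0) (W.geomPrimaryTorsion 3) 3
          (fineData (W.geomPrimaryTorsion 3) 3)) * Nat.card I.descentCokernel ∣
        Nat.card {m : W.geomPrimaryTorsion 3 | ∀ σ : absoluteGaloisGroup ℚ, σ • m = m} *
          Nat.card (EndCoinvariants (W.conjFineSelmerInfty κ γ - 1)) *
            Nat.card (integralH1 (tateRep W 3) 3 (κ.layerSubgroup 0) ⧸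
              Submodule.span ℤ_[3] {(⟨I.proj 0 s, I.proj_mem 0 s⟩ :
                integralH1 (tateRep W 3) 3 (κ.layerSubgroup 0))}) := by
  have hs0 : s ≠ 0 := by
    rintro rfl
    exact hsp (Submodule.zero_mem _)
  haveI : Module.Finite (IwasawaAlgebra 3) I.H := IwasawaH1Data.module_finite_of_isCyclotomic hκ hγ I
  haveI := I.noZeroSMulDivisors hγ
  have htors : Module.IsTorsion (IwasawaAlgebra 3) (I.H ⧸ Submodule.span (IwasawaAlgebra 3) {s}) :=
    ReducibleZetaDivisibility.isTorsion_quotient_span_singleton_of_ne_zero W 3 hκ hγ I hs0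
  -- `Sel₀(W/ℚ_∞)[3]` finite from the kernel μ-core at `p = 3` under `Irr` alone
  obtain ⟨J, hJ⟩ := Rank1Residual.CoreAssembly.coreThree_anyReduction_of_irr W κ γ I hirr hκ hγ ⟨s, hs, hsp⟩
  have hfinp := W.finite_fineSelmerInfty_pTorsion_of_forall_iterate_eq_zero κ hγ hJ
  have hchar := charIdeal_le_charIdeal_fineSelmerDual_three_of_irreducible W h134 hSerre κ γ hκ hγ hCM hirr I Y s
    hs hsp htors
  exact ⟨(FineSelmerDescentOfDivisibility.natCard_fineSelmer_invariants_mul_descentCokernel_dvd_of_charIdeal_le W 3 hκ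
      hγ I Y hfinp s hnt hchar).2.2.2.2,
    FineSelmerDescentOfDivisibility.natCard_fineSelmerZero_mul_descentCokernel_dvd_of_charIdeal_le W 3 hκ hγ I Y
      hfinp s hnt hchar⟩

end Three

end Summit.BirchSwinnertonDyer.BirchSwinnertonDyer.Theorems.MuCoreIrr
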